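import Summits.HodgeConjecture.CorCM.MultiFieldWeilCoprimeOneMember
import Mathlib.GroupTheory.Perm.Cycle.Type
import Mathlib.GroupTheory.Perm.Fin
import Mathlib.Data.Nat.Prime.Factorial
import HarnessLib

/-!
# MULTI-FIELD WEIL ENGINE — SLOTS OF PRIME SIZE: a realised tuple whose component in a slot of prime size `ℓ` has order `ℓ` ALWAYS exists (Cauchy), it is an
# `ℓ`-CYCLE, and when `ℓ` exceeds the sizes of the other slots a POWER of it is PURE (identity on every other slot) — the input of census part 6, NO Galois
# hypothesis

Cell `pub-hodgecm2` (COR-CM), seat b30 gen 29 (2026-08-24); count-neutral own lane MULTI-FIELD WEIL ENGINE (stem `MultiFieldWeil*`), sequel of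
`CorCM/MultiFieldWeilCoprimeOneMember.lean` (`transitive_realisedTuples`, `inv_mem_realisedTuples`) feeding `Census/MultiFieldWeilPureSlot.lean`.  Theorems only; no
definition, no named fact, no `sorry`, no `decide`.  The general form of the device `(π₂, σ)¹² = (1, σ²)` of gens 27–29 (decic slots) and of gen 23ʼs «Cauchy 5-cycle».

* §1 group theory of the tuples: **`exists_pow_pure`** (if the order of `π_{m₀}` is coprime to the orders of the other components, some power `π^N` has `(π^N)_{m₀} = π_{m₀}`
  and `(π^N)_m = 1` for `m ≠ m₀` — `exists_pow_eq_self_of_coprime`), **`coprime_orderOf_of_lt`** (a permutation of fewer than `ℓ` points has order prime to the prime `ℓ`: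
  its order divides `(n_m)!`), **`exists_conj_finRotate_of_orderOf_eq`** (a permutation of `ℓ = k + 2` points of order `ℓ`, `ℓ` prime, is a conjugate of the rotation
  `finRotate ℓ`: cycle type `{ℓ}`);
* §2 **`exists_orderOf_eq_mem_realisedTuples`** — for a slot `m₀` of PRIME size `ℓ = n m₀` some realised tuple has `m₀`-component of order `ℓ` (the slot image of the
  realised tuples is a transitive subgroup of `Sym(ℓ)` — `transitive_realisedTuples`, `ZarhinLie` — so `ℓ` divides its order by orbit–stabiliser and Cauchy applies);
* §3 **`exists_pure_mem_realisedTuples`** — if moreover `n m < ℓ` for all `m ≠ m₀`, a realised tuple `ρ` is PURE at `m₀` with `ρ_{m₀}` of order `ℓ` (hence an `ℓ`-cycle,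
  a conjugate rotation): the hypothesis of `Census.MultiFieldWeil.const_of_signed_pure` / `sep_of_conj_rotate`.  NO Galois hypothesis, nothing assumed about the other
  fields.  Versions pure on a SET of live slots only (for peeling several prime slots from the largest down): `exists_pow_pure_on`,
  **`exists_pure_on_mem_realisedTuples`**.
[cite: DixonMortimer1996, §1.6 and §2.1] [cite: Shimura1998, §18.2 Lemma (i)]

## References
* [DixonMortimer1996] J. D. Dixon, B. Mortimer, *Permutation Groups*, GTM 163, §1.6, §2.1.  [Shimura1998] G. Shimura, *Abelian varieties with CM and modular
  functions*, §18.2 Lemma (i).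
-/

noncomputable section

open NumberField

namespace Summit.HodgeConjecture.CorCM.MultiFieldWeil

open Finset
open Literature.AlgebraicGeometry Literature.AlgebraicGeometry.Motives
open Summit.HodgeConjecture.CorCM.Census.MultiFieldWeil

open scoped Classical

/-! ## §1 Powers of a tuple: purity from coprime component orders; prime cycles -/

section Group

variable {r : ℕ} {n : Fin r → ℕ}

/-- **A POWER OF A TUPLE IS PURE** at `m₀` when the order of its `m₀`-component is coprime to the orders of all other components: `(π^N)_{m₀} = π_{m₀}` and `(π^N)_m = 1`
for `m ≠ m₀` (`N = K·j` with `K` the product of the other orders and `(π_{m₀}^K)^j = π_{m₀}`). [cite: DixonMortimer1996, §1.6] -/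
theorem exists_pow_pure (π : PermsG n) (m₀ : Fin r) (hcop : ∀ m, m ≠ m₀ → (orderOf (π m₀)).Coprime (orderOf (π m))) :
    ∃ N : ℕ, (π ^ N) m₀ = π m₀ ∧ ∀ m, m ≠ m₀ → (π ^ N) m = 1 := by
  set K : ℕ := ∏ m ∈ univ.erase m₀, orderOf (π m) with hK
  have hKcop : K.Coprime (orderOf (π m₀)) := by
    rw [hK]
    exact Nat.Coprime.prod_left fun m hm => (hcop m (Finset.ne_of_mem_erase hm)).symm
  obtain ⟨j, hj⟩ := exists_pow_eq_self_of_coprime hKcop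
  refine ⟨K * j, ?_, fun m hm => ?_⟩
  · rw [Pi.pow_apply, pow_mul, hj]
  · have hdvd : orderOf (π m) ∣ K := by
      rw [hK]
      exact Finset.dvd_prod_of_mem (fun m => orderOf (π m)) (Finset.mem_erase.2 ⟨hm, Finset.mem_univ m⟩)
    rw [Pi.pow_apply, pow_mul, orderOf_dvd_iff_pow_eq_one.1 hdvd, one_pow]

/-- **A power pure ON A SET OF SLOTS**: if the order of `π_{m₀}` is coprime to the orders of the components on `M`, some power has `(π^N)_{m₀} = π_{m₀}` and `(π^N)_m = 1` for `m ∈ M`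
(no control, and none needed, on the other components). [cite: DixonMortimer1996, §1.6] -/
theorem exists_pow_pure_on (π : PermsG n) (m₀ : Fin r) (M : Finset (Fin r)) (hcop : ∀ m ∈ M, (orderOf (π m₀)).Coprime (orderOf (π m))) :
    ∃ N : ℕ, (π ^ N) m₀ = π m₀ ∧ ∀ m ∈ M, (π ^ N) m = 1 := by
  set K : ℕ := ∏ m ∈ M, orderOf (π m) with hK
  have hKcop : K.Coprime (orderOf (π m₀)) := by
    rw [hK]
    exact Nat.Coprime.prod_left fun m hm => (hcop m hm).symm
  obtain ⟨j, hj⟩ := exists_pow_eq_self_of_coprime hKcop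
  refine ⟨K * j, ?_, fun m hm => ?_⟩
  · rw [Pi.pow_apply, pow_mul, hj]
  · have hdvd : orderOf (π m) ∣ K := by
      rw [hK]
      exact Finset.dvd_prod_of_mem (fun m => orderOf (π m)) hm
    rw [Pi.pow_apply, pow_mul, orderOf_dvd_iff_pow_eq_one.1 hdvd, one_pow]

/-- **A permutation of fewer than `ℓ` points has order prime to the prime `ℓ`** (its order divides `k!`, which `ℓ > k` does not divide). [folklore] -/
theorem coprime_orderOf_of_lt {ℓ k : ℕ} (hℓ : ℓ.Prime) (hk : k < ℓ) (σ : Equiv.Perm (Fin k)) : ℓ.Coprime (orderOf σ) := by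
  rw [Nat.Prime.coprime_iff_not_dvd hℓ]
  intro h
  have h1 : orderOf σ ∣ Nat.factorial (Fintype.card (Fin k)) := by
    rw [← Fintype.card_perm]
    exact orderOf_dvd_card
  rw [Fintype.card_fin] at h1
  have h2 := (Nat.Prime.dvd_factorial hℓ).1 (h.trans h1)
  omega

/-- **A permutation of `ℓ = k + 2` points of order `ℓ`, `ℓ` prime, is a conjugate of the rotation `finRotate ℓ`** (its cycle type is `{ℓ}`: the cycles of an element of
prime order `ℓ` all have length `ℓ`, and there is room for one only). [cite: DixonMortimer1996, §1.6] -/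
theorem exists_conj_finRotate_of_orderOf_eq {k : ℕ} (hℓ : (k + 2).Prime) (σ : Equiv.Perm (Fin (k + 2))) (hσ : orderOf σ = k + 2) :
    ∃ g : Equiv.Perm (Fin (k + 2)), g * finRotate (k + 2) * g⁻¹ = σ := by
  have hprime : (orderOf σ).Prime := by rw [hσ]; exact hℓ
  obtain ⟨c, hc⟩ := Equiv.Perm.cycleType_prime_order hprime
  have hsum := Equiv.Perm.sum_cycleType_le σ
  rw [hc, Multiset.sum_replicate, smul_eq_mul, hσ, Fintype.card_fin] at hsum
  have hc0 : c = 0 := by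
    by_contra h0
    have : 2 * (k + 2) ≤ (c + 1) * (k + 2) := Nat.mul_le_mul_right _ (by omega)
    omega
  rw [hc0, zero_add, Multiset.replicate_one, hσ] at hc
  have hconj : IsConj (finRotate (k + 2)) σ := Equiv.Perm.isConj_of_cycleType_eq (by rw [cycleType_finRotate, hc])
  exact isConj_iff.1 hconj

end Group

/-! ## §2 A realised tuple with a component of order `ℓ` in a slot of prime size `ℓ` -/

section Realised

variable {I : Type} {r : ℕ} {Kf : I → Type} [∀ i, Field (Kf i)] [∀ i, NumberField (Kf i)] {i₀ : I} {is : Fin r → I} {n : Fin r → ℕ}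
  {e : ∀ m : Fin r, (Kf (is m) →+* ℂ) ≃ Fin (n m) × Bool} {τ : Kf i₀ →+* ℂ} {im : ∀ m : Fin r, Kf i₀ →+* Kf (is m)}
  (he_sign : ∀ (m : Fin r) (s : Kf (is m) →+* ℂ), (e m s).2 = true ↔ s.comp (im m) = τ)

include he_sign in
/-- **Cauchy in the slot image.**  For a slot `m₀` of PRIME size `ℓ = n m₀`, some realised tuple has `m₀`-component of order `ℓ`: the `m₀`-components of the realised tuples form a
subgroup of `Sym(ℓ)` that is transitive (`transitive_realisedTuples`), so `ℓ = [subgroup : stabiliser]` divides its order and Cauchy's theorem gives an element of order `ℓ`.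
NO Galois hypothesis. [cite: DixonMortimer1996, §1.6 and §2.1] [cite: Shimura1998, §18.2 Lemma (i)] -/
theorem exists_orderOf_eq_mem_realisedTuples (m₀ : Fin r) (hℓ : (n m₀).Prime) : ∃ π ∈ realisedTuples e τ, orderOf (π m₀) = n m₀ := by
  have hmul : ∀ π ∈ realisedTuples e τ, ∀ π' ∈ realisedTuples e τ, π * π' ∈ realisedTuples e τ := fun π hπ π' hπ' => mul_mem_realisedTuples e τ hπ hπ'
  have h1 : (1 : PermsG n) ∈ realisedTuples e τ :=
    one_mem_of_closed hmul (fun π hπ => inv_mem_realisedTuples hπ) (realisedTuples_nonempty (e := e) he_sign)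
  let H : Subgroup (Equiv.Perm (Fin (n m₀))) :=
    { carrier := {σ | ∃ π ∈ realisedTuples e τ, π m₀ = σ}
      mul_mem' := fun {σ₁ σ₂} h₁ h₂ => by
        obtain ⟨π₁, hπ₁, rfl⟩ := h₁
        obtain ⟨π₂, hπ₂, rfl⟩ := h₂
        exact ⟨π₁ * π₂, hmul π₁ hπ₁ π₂ hπ₂, rfl⟩
      one_mem' := ⟨1, h1, rfl⟩
      inv_mem' := fun {σ} h => by
        obtain ⟨π, hπ, rfl⟩ := h
        exact ⟨π⁻¹, inv_mem_realisedTuples hπ, rfl⟩ }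
  haveI : MulAction.IsPretransitive H (Fin (n m₀)) := ⟨fun a b => by
    obtain ⟨π, hπ, hab⟩ := transitive_realisedTuples (e := e) he_sign m₀ a b
    exact ⟨⟨π m₀, π, hπ, rfl⟩, hab⟩⟩
  haveI : NeZero (n m₀) := ⟨hℓ.ne_zero⟩
  have hidx : (MulAction.stabilizer H (0 : Fin (n m₀))).index = n m₀ := by
    rw [MulAction.index_stabilizer_of_transitive, Nat.card_eq_fintype_card, Fintype.card_fin]
  have hmulcard := (MulAction.stabilizer H (0 : Fin (n m₀))).index_mul_card
  have hdvd : n m₀ ∣ Nat.card H := ⟨Nat.card (MulAction.stabilizer H (0 : Fin (n m₀))), by rw [← hmulcard, hidx]⟩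
  haveI : Fact (n m₀).Prime := ⟨hℓ⟩
  obtain ⟨σ, hσ⟩ := exists_prime_orderOf_dvd_card' (n m₀) hdvd
  obtain ⟨π, hπ, hπσ⟩ := σ.2
  refine ⟨π, hπ, ?_⟩
  rw [hπσ, ← Subgroup.orderOf_coe σ] at *
  exact hσ

/-! ## §3 A PURE realised tuple rotating a slot of prime size larger than the other slots -/

include he_sign in
/-- **A PURE REALISED ROTATION.**  For a slot `m₀` of PRIME size `ℓ = n m₀` with `n m < ℓ` for every other slot `m`, some realised tuple `ρ` is the identity on every slot
`m ≠ m₀` and has `m₀`-component of order `ℓ` (an `ℓ`-cycle — a conjugate of `finRotate ℓ` by `exists_conj_finRotate_of_orderOf_eq`): a suitable power of the tuple of §2.  This is the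
pure element of `Census.MultiFieldWeil.const_of_signed_pure`; NO Galois hypothesis and nothing assumed about the other fields. [cite: DixonMortimer1996, §1.6 and §2.1] -/
theorem exists_pure_mem_realisedTuples (m₀ : Fin r) (hℓ : (n m₀).Prime) (hlt : ∀ m, m ≠ m₀ → n m < n m₀) :
    ∃ ρ ∈ realisedTuples e τ, (∀ m, m ≠ m₀ → ρ m = 1) ∧ orderOf (ρ m₀) = n m₀ := by
  obtain ⟨π, hπ, hord⟩ := exists_orderOf_eq_mem_realisedTuples (e := e) he_sign m₀ hℓ
  have hcop : ∀ m, m ≠ m₀ → (orderOf (π m₀)).Coprime (orderOf (π m)) := fun m hm => by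
    rw [hord]
    exact coprime_orderOf_of_lt hℓ (hlt m hm) (π m)
  obtain ⟨N, hN₀, hN⟩ := exists_pow_pure π m₀ hcop
  refine ⟨π ^ N, ?_, hN, by rw [hN₀, hord]⟩
  cases N with
  | zero =>
    rw [pow_zero]
    exact one_mem_of_closed (fun π hπ π' hπ' => mul_mem_realisedTuples e τ hπ hπ') (fun π hπ => inv_mem_realisedTuples hπ)
      (realisedTuples_nonempty (e := e) he_sign)
  | succ N => exact pow_mem_realisedTuples e τ hπ N

include he_sign in
/-- **A REALISED ROTATION PURE ON THE LIVE SLOTS.**  For a slot `m₀` of PRIME size `ℓ = n m₀` and a set `M` of slots with `n m < ℓ` for `m ∈ M`, some realised tuple `ρ` is the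
identity on every slot of `M` and has `m₀`-component of order `ℓ` — the pure element of `Census.MultiFieldWeil.const_of_signed_pure_on` when the slots outside `M ∪ {m₀}` (e.g. larger
prime slots) have been peeled already.  NO Galois hypothesis. [cite: DixonMortimer1996, §1.6 and §2.1] -/
theorem exists_pure_on_mem_realisedTuples (m₀ : Fin r) (hℓ : (n m₀).Prime) (M : Finset (Fin r)) (hlt : ∀ m ∈ M, n m < n m₀) :
    ∃ ρ ∈ realisedTuples e τ, (∀ m ∈ M, ρ m = 1) ∧ orderOf (ρ m₀) = n m₀ := by
  obtain ⟨π, hπ, hord⟩ := exists_orderOf_eq_mem_realisedTuples (e := e) he_sign m₀ hℓ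
  have hcop : ∀ m ∈ M, (orderOf (π m₀)).Coprime (orderOf (π m)) := fun m hm => by
    rw [hord]
    exact coprime_orderOf_of_lt hℓ (hlt m hm) (π m)
  obtain ⟨N, hN₀, hN⟩ := exists_pow_pure_on π m₀ M hcop
  refine ⟨π ^ N, ?_, hN, by rw [hN₀, hord]⟩
  cases N with
  | zero =>
    rw [pow_zero]
    exact one_mem_of_closed (fun π hπ π' hπ' => mul_mem_realisedTuples e τ hπ hπ') (fun π hπ => inv_mem_realisedTuples hπ)
      (realisedTuples_nonempty (e := e) he_sign)
  | succ N => exact pow_mem_realisedTuples e τ hπ N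

end Realised

end Summit.HodgeConjecture.CorCM.MultiFieldWeil

end
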